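import Summits.QuantumFields.BalabanUV.Beta.GAN24.InsertionChainDecay
import Summits.QuantumFields.BalabanUV.T4Continuum.Support.BalabanAveragedCoerciveTower
import Summits.QuantumFields.BalabanUV.T4Continuum.Support.BalabanAveragingPairing

/-!
# `BalabanUV.Beta.GAN24.InsertionChainDecayBalaban` — binder row G-an2-4 ∕ (CONV-C), route R7 «TWO CURRENCIES», PART 126: THE COMBES–THOMAS DICTIONARY
# FOR BAŁABAN's OWN (1.18)-AVERAGED TOWER, AND THE INSERTION CHAINS ON IT IN BOTH CURRENCIES.  The NE2 swarm's dictionary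
# (`CTAveragedTowerDecay.entryDecay_avgTow_of_conjInv`) asks the averagings to have King's INDICATOR structure; Bałaban's one-step averaging
# `QB = Qavg ∘ Lavg` ([B5] (1.11)∕(1.18): block mean of the straight-contour average) has not — its composite `Atow QBlev k` IS the printed `Q_k`
# (`BalabanAveragedCoerciveTower.Atow_QBlev_eq_submatrix`), whose row `(y, μ)` is supported on the blocks at sup-distance `≤ 1` from `y`
# (`VectorTailsCov.tdist_blockOf_le_one_of_QvOp_ne_zero`).  §1 re-proves the dictionary from SUPPORT hypotheses alone (`ρ_y ≤ c₀` on the support of row `y`,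
# `ρ_y ≥ dist(x,y) − c` on the support of row `x` ⟹ `EntryDecay dist (avgTow A r X k) (K·e^{κ(c + c₀)}) κ`); §2 verifies them for `QBlev` at the canonical
# weights with `(c, c₀) = (3, 1)`; §3–§4 deliver, on BAŁABAN's tower and UNCONDITIONALLY at `U = 1`, the level- and volume-uniform entry decay of the
# averaged free covariance `unitCovB k = (L^d)^k·Q_k𝒢^{(k)}Q_kᴴ` ((1.71)) for EVERY `a > 0` and EVERY torus, and the (CONV-C) shape (rate `√(L⁻¹)` AND decay
# `κ∕2`) for every u-derivative insertion chain of the first-order model read through Bałaban's averaging (unit b2b-balaban-gan24-p3, gen 52; v1)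

NOT IN PRINT; OUR PROOF ([folklore] composition BY NAME: PART 124, PART 115 (`towerLimitRate_insertion`), NE2's `BalabanAveragingPairing.freeTowerLaws_balaban` (the `U = 1`
tower laws for Bałaban's averaging — a THEOREM), `BalabanAveragedTowerUnit` (`unitCovB`, `towerLimitRate_QB`), `BalabanAveragedCoerciveTower.Atow_QBlev_eq_submatrix`, the β-cell's
`Beta/VectorTailsCov` (`tdist`, `tdist_blockOf_le_one_of_QvOp_ne_zero`), the NE2 swarm's `CTAveragedTowerDecay` ∕ `CTKingTowerWeights` ∕ `CTConjugatedHbd` ∕ `CTConjDefectDischarge`,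
and the row owner's `DecayRateInterpolation.decayRate_of_towerLimitRate`.  [Balaban1984PropagatorsI] (1.18) p. 20, (1.71) p. 30 are TEXT LOCATIONS of the objects; [King1986]
Lemma 4.5 (4.38) p. 674 is the printed SHAPE of the conclusion; nothing printed is a hypothesis).
HONEST FRAMING (cell contract, verbatim): «discharging `BetaPertH` makes Bałaban's UV stability UNCONDITIONAL — a real constructive-QFT result; it is NOT the
continuum limit and NOT the Clay problem.»  HONEST DEPENDENCY (verbatim): «continuum YM on T⁴ ⇐ BetaPertH ∧ nine spine estimates (0/9 proved); BetaPertH ⇐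
(D1) ∧ (D4) ∧ CAP+tail; G-an2-4 gates asym, D1 and NE2/3/4.»

WHY THIS FILE.  PARTs 124–125 ran the two-currency engine on KING's block-mean averaging.  Bałaban's transformations average with (1.18), and this lineage's
effective-form results (PARTs 118 ∕ 121 ∕ 123) live on the (1.18)-averaged tower, where `uniformCoercive_unitCovB` is a theorem.  The dictionary only ever used two
facts about the block test vectors `a_x = star (Atow A k x ·)`: their size `nsq a_x ≤ r^{−k}` and WHERE they are supported relative to the weight; and `e^{κρ}Xe^{−κρ}` is
invariant under constant shifts of `ρ`, so a weight `≤ c₀` on the centre row's support costs a factor `e^{κc₀}` (§1).  For Bałaban's averaging the support spills into the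
neighbouring blocks (the straight contours of `L^k` fine bonds leave the block), which the canonical weights absorb with `(c, c₀) = (3, 1)` (§2).

WHAT THIS FILE PROVES (0 sorry, 0 `def`, nothing cited; `QBlev k` Bałaban's one-step averaging between levels `k+1 → k`, `unitCovB k = avgTow QBlev L^d 𝒢 k`,
`ρ_{k,y} = CTKingTowerWeights.rho k y`, `distK` the unit-torus sup-distance; `L ≥ 1`, `M : Fin d → ℕ`, `a > 0`):
* §1 (ANY index tower, ANY averagings with `‖A_j‖² ≤ r⁻¹`) `conjMat_sub_const` (shift invariance), **`entryDecay_avgTow_of_support`** (the dictionary from support hypotheses,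
  constant `K·e^{κ(c + c₀)}`).
* §2 (the geometry of (1.18)) `toM_eq_unitSites`; **`tdist_blockOf_le_one_of_Atow_QBlev_ne_zero`** (row `(y,μ)` of `Q_k` lives on the blocks at sup-distance `≤ 1` from `y`);
  **`rho_le_one_of_near`** (`ρ_{k,y} ≤ 1` there) and **`distK_sub_three_le_rho_of_near`** (`ρ_{k,y} ≥ distK x y − 3` on the blocks near `x`).
* §3 **`hdecB_of_conjBound`** (ANY level operators: `∀ k y, ‖conjMat κ ρ_{k,y} ρ_{k,y} (X k)‖ ≤ K` ⟹ `∀ k, EntryDecay distK (avgTow QBlev L^d X k) (K·e^{4κ}) κ`);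
  **`hdec_unitCovB_of_wCoercive`** (`hW` alone ⟹ `EntryDecay distK (unitCovB k) (γw⁻¹e^{4κ}) κ`); **`decayStations_unitCovB`** (`L ≥ 2`, `a′ > 0`, `κ ≥ 0` below the three
  closed-form thresholds — NO displayed binder): the (1.18)-averaged unit-lattice free covariance tower converges to a limit with entry decay `((γ_D − J)⁻¹e^{4κ}, κ)` and obeys
  King's shapes `(√(2B·CQB∕(1−L⁻¹)), κ∕2, √(L⁻¹))` ∕ `(√(2B·2CQB∕(1−L⁻¹)), κ∕2, √(L⁻¹))`; **`exists_rate_unitCovB`** (`∃ κ ∈ (0,1]` depending on `(d, a)` only, for ALL tori).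
  HONEST NOTE: for `a = 1` on CUBIC tori the two (CONV-C) clauses for this constituent are ALREADY in the tree by the road-P2 swarm's kernel route
  (`GAN24/AveragedPropagatorTowerDecayCubic`); §3 is the Combes–Thomas route (every `a > 0`, every torus, the sup-distance `distK`) — not a new estimate class.
* §4 (insertion chains on Bałaban's tower) **`towerLimitRate_insertion_QB`** (PART 115 over `freeTowerLaws_balaban`: every `PerturbationLaws (Δ_a^{(·)}) P J κ₀ (C₂L^{−k})` family, every
  order `n`, constant `C^B_n = (n+1)κ₀^nCJ + nκ₀^{n−1}C₂ + κ₀^n(2dCst + 2dLCst)`); **`hdecB_insertion_of_wCoercive`**; **`decayStations_insertion_QB`** (the join);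
  **`decayStations_firstOrderInsertion_QB`** and **`exists_rate_firstOrderInsertion_QB`** (the first-order model `P_k = Σ_μ diag(V^{(k)}_μ)∇^{(k)}_μ`, `LipschitzBackground V α β`:
  for EVERY order `n`, the (1.18)-averaged unit-lattice images of `(𝒢^{(k)}P_k)^n𝒢^{(k)}` obey `‖(c^{(n)}_{k+1} − c^{(n)}_k)(x,y)‖ ≤ B·(√(L⁻¹))^k·e^{−(κ∕2)·distK(x,y)}` — UNCONDITIONAL,
  one `κ > 0` for all tori, backgrounds and orders).
WHAT IT DOES NOT DO: the effective form `Σ_k = c_k⁻¹ − a` and its u-derivative (PART 118's objects — they need the Combes–Thomas step ON THE UNIT LATTICE, follower); Bałaban's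
COVARIANT averaging `Q_k(U)` and his Table-T vertices; infinite volume; a number for `κ`.  SUPPLIER work (junction R7 × NE2's Δ3-CT chain × the (1.18) tower); no consumer of
record; NEVER «G-an2-4 closed»; NOT (CONV-C), NOT D1, NOT `BetaPertH`, NOT continuum, NOT Clay.  Records: `HOME/b2b-balaban-gan24-p3/gen52/README.md`.
-/

noncomputable section

open scoped BigOperators ComplexConjugate Matrix Matrix.Norms.L2Operator
open Filter Topology

namespace Summit.QuantumFields.BalabanUV.Beta.GAN24.InsertionChainDecayBalaban

open Literature.MathematicalPhysics.QuantumFieldTheory.Balaban1983to89.B5Prop11Plancherel (Cst Cst_nonneg Tor fine)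
open Literature.MathematicalPhysics.QuantumFieldTheory.Balaban1983to89.B5Prop11Lower (nsq nsq_nonneg)
open Literature.MathematicalPhysics.QuantumFieldTheory.Balaban1983to89.B5G183RateUnitTower (lev)
open Literature.MathematicalPhysics.QuantumFieldTheory.Balaban1983to89.B5Blocks16 (blockOf)
open Literature.MathematicalPhysics.QuantumFieldTheory.Balaban1983to89.Beta.VectorTailsCov (tdist tdist_self tdist_triangle tdist_comm
  tdist_blockOf_le_one_of_QvOp_ne_zero)
open Summit.QuantumFields.BalabanUV.T4Continuum
open Summit.QuantumFields.BalabanUV.T4Continuum.CovariantAveragingTower (Atow avgTow TowerLimitRate towerLimitRate_of_oneStepAveragedLaw)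
open Summit.QuantumFields.BalabanUV.T4Continuum.BalabanAveragedTowerUnit (idx QBlev calGlev unitCovB one_le_lev' opNorm_QBlev_sq_le towerLimitRate_QB)
open Summit.QuantumFields.BalabanUV.T4Continuum.BalabanAveragedCoerciveTower (unitSites val_unitSites unitIdx unitIdx_apply Atow_QBlev_eq_submatrix)
open Summit.QuantumFields.BalabanUV.T4Continuum.BalabanAveragingPairing (FQBlev freeTowerLaws_balaban)
open Summit.QuantumFields.BalabanUV.T4Continuum.BalabanLineAverage (CQB CQB_nonneg)
open Summit.QuantumFields.BalabanUV.T4Continuum.BackgroundResolventTower (PerturbationLaws)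
open Summit.QuantumFields.BalabanUV.T4Continuum.KingPairingPlantedLaw (JpcT calDalev calDalev_inv CJ CJ_nonneg)
open Summit.QuantumFields.BalabanUV.T4Continuum.FirstOrderBackgroundModel (LipschitzBackground Pmodel C2model perturbationLaws_firstOrder)
open Summit.QuantumFields.BalabanUV.T4Continuum.ScalarCovariantCTWeighted (wvec)
open Summit.QuantumFields.BalabanUV.T4Continuum.CTWeightedCoercivity (conjMat conjMat_apply WCoercive)
open Summit.QuantumFields.BalabanUV.T4Continuum.CTAveragedTowerDecay (pairing_le_of_opNorm_conjMat avgTow_apply_eq_pairing nsq_star_Atow_le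
  opNorm_conjMat_inv_le_of_wCoercive)
open Summit.QuantumFields.BalabanUV.T4Continuum.CTKingTowerWeights (toM val_toM rho rho_apply rhoSite ctr distK distK_comm tdist_ctr_bounds blockOf_eq_toM_prtk)
open Summit.QuantumFields.BalabanUV.T4Continuum.CTConjugatedHbd (G2 wCoercive_calDa_of_conjDefect)
open Summit.QuantumFields.BalabanUV.T4Continuum.CTConjDefectDischarge (conjDefect_calDalev_rho max_JA_lt_gamD)
open Summit.QuantumFields.BalabanUV.T4Continuum.DirichletRegionTower (gamD gamD_pos)
open Summit.QuantumFields.BalabanUV.T4Continuum.ScalarAveragedPropagator (gammaPs)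
open Summit.QuantumFields.BalabanUV.T4Continuum.ScalarAveragedCompression (sigma0)
open Summit.QuantumFields.BalabanUV.T4Continuum.CTScalarGreen (Jfree)
open Summit.QuantumFields.BalabanUV.T4Continuum.CTGaugeTerm (deltaK)
open Summit.QuantumFields.BalabanUV.T4Continuum.CTVectorPropagator (JA)
open Summit.QuantumFields.BalabanUV.T4Continuum.BlockSumDecay (prtk prtQ)
open Summit.QuantumFields.BalabanUV.T4Continuum.DecayRateInterpolation (EntryDecay DecayRate TwoLevelDecayRate decayRate_of_towerLimitRate)
open Summit.QuantumFields.BalabanUV.Beta.GAN24.InsertionChainLaw (towerLimitRate_insertion)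
open Summit.QuantumFields.BalabanUV.Beta.GAN24.InsertionChainDecay (opNorm_conjMat_insertion_le_of_wCoercive nonneg_of_perturbationLaws hPc_firstOrder
  exists_admissible_rate)

/-! ## §1 The dictionary from SUPPORT hypotheses (any averagings, any index tower) -/

section Generic

variable {τ σ : Type*} [Fintype τ] [Fintype σ]

omit [Fintype τ] [Fintype σ] in
/-- **shift invariance**: `e^{κ(ρ − c₀)}Xe^{−κ(σ − c₀)} = e^{κρ}Xe^{−κσ}`. [folklore] -/
theorem conjMat_sub_const (κ c₀ : ℝ) (ρ : τ → ℝ) (σ' : σ → ℝ) (X : Matrix τ σ ℂ) :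
    conjMat κ (fun e => ρ e - c₀) (fun e => σ' e - c₀) X = conjMat κ ρ σ' X := by
  ext e e'
  simp only [conjMat_apply]
  congr 3
  ring

variable {ι : ℕ → Type*} [∀ k, Fintype (ι k)] [∀ k, DecidableEq (ι k)]

/-- **`entryDecay_avgTow_of_support` — THE COMBES–THOMAS DICTIONARY FROM SUPPORT HYPOTHESES** [our proof].  Let `‖A_j‖² ≤ r⁻¹` (`r > 0`), and let
`ρ : ι 0 → ι k → ℝ` be centre-indexed weights with `ρ_y ≤ c₀` on the support of row `y` of the composite averaging `Atow A k` and `ρ_y ≥ dist(x,y) − c` on the support of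
row `x`.  If `‖conjMat κ (ρ y) (ρ y) (X k)‖ ≤ K` for every centre `y` (`κ ≥ 0`), then `EntryDecay dist (avgTow A r X k) (K·e^{κ(c + c₀)}) κ` — the NE2 swarm's
`entryDecay_avgTow_of_conjInv` with King's indicator structure replaced by the two support facts it was used for (and the centre normalisation `≤ 0` relaxed to `≤ c₀` by
shift invariance). -/
theorem entryDecay_avgTow_of_support {A : (k : ℕ) → Matrix (ι k) (ι (k + 1)) ℂ} {r : ℝ} (hr : 0 < r) (hA : ∀ k, ‖A k‖ ^ 2 ≤ r⁻¹)
    {X : (k : ℕ) → Matrix (ι k) (ι k) ℂ} {k : ℕ} {κ K c c₀ : ℝ} (hκ : 0 ≤ κ) {dist : ι 0 → ι 0 → ℝ} (ρ : ι 0 → ι k → ℝ)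
    (hK : ∀ y, ‖conjMat κ (ρ y) (ρ y) (X k)‖ ≤ K) (h0 : ∀ y u, Atow A k y u ≠ 0 → ρ y u ≤ c₀)
    (hR : ∀ x y u, Atow A k x u ≠ 0 → dist x y - c ≤ ρ y u) :
    EntryDecay dist (avgTow A r X k) (K * Real.exp (κ * (c + c₀))) κ := by
  intro x y
  rw [avgTow_apply_eq_pairing, norm_mul, norm_pow, Complex.norm_real, Real.norm_of_nonneg hr.le]
  -- shifted weight `ρ' = ρ_y − c₀`: `≤ 0` on the support of row `y`, `≥ dist x y − (c + c₀)` on the support of row `x`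
  set ρ' : ι k → ℝ := fun u => ρ y u - c₀ with hρ'
  have hK' : ‖conjMat κ ρ' ρ' (X k)‖ ≤ K := by rw [hρ', conjMat_sub_const]; exact hK y
  have hne : ∀ (z : ι 0) (u : ι k), star (Atow A k z) u ≠ 0 → Atow A k z u ≠ 0 := fun z u hu => by
    rw [Pi.star_apply] at hu
    exact fun h0 => hu (by rw [h0, star_zero])
  have hu : ∀ u, star (Atow A k x) u ≠ 0 → dist x y - (c + c₀) ≤ ρ' u := fun u hu => by
    have h := hR x y u (hne x u hu)
    show dist x y - (c + c₀) ≤ ρ y u - c₀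
    linarith
  have hv : ∀ u, star (Atow A k y) u ≠ 0 → ρ' u ≤ 0 := fun u hu => by
    have h := h0 y u (hne y u hu)
    show ρ y u - c₀ ≤ 0
    linarith
  have hp := pairing_le_of_opNorm_conjMat hκ hK' hu hv
  have hrk : 0 < r ^ k := pow_pos hr k
  have hn : ∀ z : ι 0, Real.sqrt (nsq (star (Atow A k z))) ≤ Real.sqrt ((r ^ k)⁻¹) :=
    fun z => Real.sqrt_le_sqrt (nsq_star_Atow_le A hr hA k z)
  have hK0 : 0 ≤ K := (norm_nonneg _).trans (hK y)
  have hss : Real.sqrt ((r ^ k)⁻¹) * Real.sqrt ((r ^ k)⁻¹) = (r ^ k)⁻¹ := Real.mul_self_sqrt (inv_nonneg.mpr hrk.le)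
  calc r ^ k * ‖star (star (Atow A k x)) ⬝ᵥ (X k *ᵥ star (Atow A k y))‖
      ≤ r ^ k * (K * Real.exp (-(κ * (dist x y - (c + c₀)))) * (Real.sqrt ((r ^ k)⁻¹) * Real.sqrt ((r ^ k)⁻¹))) := by
        refine mul_le_mul_of_nonneg_left (hp.trans ?_) hrk.le
        exact mul_le_mul_of_nonneg_left (mul_le_mul (hn x) (hn y) (Real.sqrt_nonneg _) (Real.sqrt_nonneg _)) (by positivity)
    _ = K * Real.exp (κ * (c + c₀)) * Real.exp (-(κ * dist x y)) := by
        rw [hss, show -(κ * (dist x y - (c + c₀))) = κ * (c + c₀) + -(κ * dist x y) by ring, Real.exp_add]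
        field_simp

end Generic

/-! ## §2 The geometry of (1.18): support of the composite averaging, and the canonical weights there -/

section Geometry

variable {d : ℕ} (L : ℕ) [NeZero L] (M : Fin d → ℕ) [hM : ∀ μ, NeZero (M μ)]

/-- the two readings of a unit site in `Tor M` agree (both preserve the integer coordinates). [folklore] -/
theorem toM_eq_unitSites (y : Tor (fine (lev L 0) M)) : toM L M y = unitSites M y := by
  funext ν; apply ZMod.val_injective; rw [val_toM, val_unitSites]; exact rfl

/-- **THE SUPPORT OF BAŁABAN's COMPOSITE AVERAGING**: an entry `(Atow QBlev k) (y,μ) (u,ν) ≠ 0` forces the block of the fine site `u` to lie at sup-distance `≤ 1` from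
the unit site `y` — `Atow QBlev k` IS the printed `Q_k` of (1.18) with `L^k` for `L` (`Atow_QBlev_eq_submatrix`), whose staples have length `L^k` fine bonds
(`VectorTailsCov.tdist_blockOf_le_one_of_QvOp_ne_zero`). [cite: Balaban1984PropagatorsI, (1.18) p.20 (the object)] -/
theorem tdist_blockOf_le_one_of_Atow_QBlev_ne_zero (k : ℕ) (y : idx L M 0) (u : idx L M k) (h : Atow (QBlev L M) k y u ≠ 0) :
    tdist (toM L M y.1) (blockOf (lev L k) M u.1) ≤ 1 := by
  rw [Atow_QBlev_eq_submatrix, Matrix.submatrix_apply, unitIdx_apply] at h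
  rw [toM_eq_unitSites]
  exact tdist_blockOf_le_one_of_QvOp_ne_zero (lev L k) M (unitSites M y.1) y.2 u.1 u.2 h

/-- **(G2a′) THE CANONICAL WEIGHT IS `≤ 1` ON THE BLOCKS NEXT TO ITS CENTRE**: `tdist(toM y, block u) ≤ 1 ⟹ ρ_{k,y}(u) ≤ 1`
(`tdist(ctr_k y, u) ≤ n_k·1 + (n_k − 1)`). [folklore] -/
theorem rho_le_one_of_near (k : ℕ) (y : idx L M 0) (u : idx L M k) (h : tdist (toM L M y.1) (blockOf (lev L k) M u.1) ≤ 1) :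
    rho L M k y u ≤ 1 := by
  have hn1 : 1 ≤ lev L k := one_le_lev' L k
  have hn : (0 : ℝ) < (lev L k : ℝ) := by exact_mod_cast hn1
  have hb := (tdist_ctr_bounds L M k y u).1
  rw [← blockOf_eq_toM_prtk] at hb
  have hb' : tdist (ctr L M k y) u.1 ≤ lev L k * 1 + (lev L k - 1) := hb.trans (by gcongr)
  have hcast : (tdist (ctr L M k y) u.1 : ℝ) ≤ (lev L k : ℝ) + ((lev L k : ℝ) - 1) := by
    have := (Nat.cast_le (α := ℝ)).mpr hb'
    rw [Nat.cast_add, Nat.mul_one, Nat.cast_sub hn1, Nat.cast_one] at this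
    exact this
  rw [rho_apply]
  unfold rhoSite
  rw [sub_le_iff_le_add, div_le_iff₀ hn]
  linarith

/-- **(G2b′) THE CANONICAL WEIGHT DOMINATES THE DISTANCE UP TO `3` ON THE BLOCKS NEXT TO ANOTHER UNIT SITE**: `tdist(toM x, block u) ≤ 1 ⟹ distK x y − 3 ≤ ρ_{k,y}(u)`
(`n_k·tdist(toM y, block u) ≤ tdist(ctr_k y, u) + (n_k − 1)` and the triangle inequality on the unit torus). [folklore] -/
theorem distK_sub_three_le_rho_of_near (k : ℕ) (x y : idx L M 0) (u : idx L M k) (h : tdist (toM L M x.1) (blockOf (lev L k) M u.1) ≤ 1) :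
    distK L M x y - 3 ≤ rho L M k y u := by
  have hn1 : 1 ≤ lev L k := one_le_lev' L k
  have hn : (0 : ℝ) < (lev L k : ℝ) := by exact_mod_cast hn1
  set B := blockOf (lev L k) M u.1 with hB
  have hb := (tdist_ctr_bounds L M k y u).2
  rw [← blockOf_eq_toM_prtk] at hb
  -- `n·T_y ≤ tdist(ctr y, u) + (n − 1)` in `ℝ`
  have hb' : (lev L k : ℝ) * (tdist (toM L M y.1) B : ℝ) ≤ (tdist (ctr L M k y) u.1 : ℝ) + ((lev L k : ℝ) - 1) := by
    have := (Nat.cast_le (α := ℝ)).mpr hb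
    rw [Nat.cast_add, Nat.cast_mul, Nat.cast_sub hn1, Nat.cast_one] at this
    exact this
  -- triangle: `distK x y ≤ tdist(toM x, B) + tdist(B, toM y) ≤ 1 + T_y`
  have htri : (tdist (toM L M x.1) (toM L M y.1) : ℝ) ≤ 1 + (tdist (toM L M y.1) B : ℝ) := by
    have h1 : tdist (toM L M x.1) (toM L M y.1) ≤ tdist (toM L M x.1) B + tdist B (toM L M y.1) := tdist_triangle _ _ _
    rw [tdist_comm B] at h1
    have h2 : tdist (toM L M x.1) (toM L M y.1) ≤ 1 + tdist (toM L M y.1) B := h1.trans (by omega)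
    exact_mod_cast h2
  have hT0 : (0 : ℝ) ≤ (tdist (toM L M y.1) B : ℝ) := Nat.cast_nonneg _
  rw [distK, rho_apply]
  unfold rhoSite
  rw [le_sub_iff_add_le, le_div_iff₀ hn]
  nlinarith

end Geometry

/-! ## §3 `hdec` on Bałaban's tower for any level operators; the (1.18)-averaged free covariance, unconditionally -/

section Tower

variable {d : ℕ} (L : ℕ) [NeZero L] (M : Fin d → ℕ) [hM : ∀ μ, NeZero (M μ)]

/-- **`hdecB_of_conjBound` — THE DICTIONARY ON BAŁABAN's (1.18)-AVERAGED TOWER** [our proof]: for ANY level operators `X_k`, a centre-uniform bound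
`‖conjMat κ ρ_{k,y} ρ_{k,y} (X k)‖ ≤ K` at the canonical weights (`κ ≥ 0`) gives `EntryDecay distK ((L^d)^k·Q_kX_kQ_kᴴ) (K·e^{4κ}) κ` at EVERY level
(`(c, c₀) = (3, 1)` in §1). -/
theorem hdecB_of_conjBound {X : (k : ℕ) → Matrix (idx L M k) (idx L M k) ℂ} {κ K : ℝ} (hκ : 0 ≤ κ)
    (hK : ∀ (k : ℕ) (y : idx L M 0), ‖conjMat κ (rho L M k y) (rho L M k y) (X k)‖ ≤ K) (k : ℕ) :
    EntryDecay (distK L M) (avgTow (QBlev L M) ((L : ℝ) ^ d) X k) (K * Real.exp (κ * 4)) κ := by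
  have hLd : (0 : ℝ) < (L : ℝ) ^ d := pow_pos (by exact_mod_cast Nat.pos_of_ne_zero (NeZero.ne L)) d
  have h := entryDecay_avgTow_of_support (X := X) (k := k) (c := 3) (c₀ := 1) (dist := distK L M) hLd (opNorm_QBlev_sq_le L M) hκ
    (fun y => rho L M k y) (hK k)
    (fun y u hu => rho_le_one_of_near L M k y u (tdist_blockOf_le_one_of_Atow_QBlev_ne_zero L M k y u hu))
    (fun x y u hu => distK_sub_three_le_rho_of_near L M k x y u (tdist_blockOf_le_one_of_Atow_QBlev_ne_zero L M k x u hu))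
  norm_num at h
  exact h

variable (a : ℝ) (ha : 0 < a)

/-- **`hdec_unitCovB_of_wCoercive`** [our proof]: the `U = 1` weighted coercivity `hW : ∀ k y, WCoercive (Δ_a^{(k)}) κ ρ_{k,y} γw` ALONE gives the level- and volume-uniform
entry decay of the (1.18)-averaged unit-lattice free covariance: `EntryDecay distK (unitCovB k) (γw⁻¹e^{4κ}) κ`. [cite: Balaban1984PropagatorsI, (1.71) p.30 (the object)] -/
theorem hdec_unitCovB_of_wCoercive {κ γw : ℝ} (hκ : 0 ≤ κ) (hγ : 0 < γw)
    (hW : ∀ (k : ℕ) (y : idx L M 0), WCoercive (calDalev L M a ha k) κ (rho L M k y) γw) (k : ℕ) :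
    EntryDecay (distK L M) (unitCovB L M a ha k) (γw⁻¹ * Real.exp (κ * 4)) κ := by
  have h := hdecB_of_conjBound L M (X := fun k => (calDalev L M a ha k)⁻¹) hκ
    (fun k y => opNorm_conjMat_inv_le_of_wCoercive (hW k y) hγ) k
  have e : (fun k => (calDalev L M a ha k)⁻¹) = calGlev L M a ha := funext fun k => calDalev_inv L M a ha k
  rw [e] at h
  exact h

/-- **`decayStations_unitCovB` — THE (1.18)-AVERAGED FREE COVARIANCE IN BOTH CURRENCIES, UNCONDITIONALLY** [our proof] (`L ≥ 2`; `a′ > 0`, `κ ≥ 0` below the three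
closed-form thresholds in `(d, a, a′)`, NO displayed binder): `unitCovB k → c_∞` with `EntryDecay distK c_∞ B κ`, `B = (γ_D − J)⁻¹e^{4κ}`, `J = max (JA d a a′ κ 1) 0`, and King's
two shapes at `(κ∕2, √(L⁻¹))` — rate half NE2's `towerLimitRate_QB`, decay half §3 over `conjDefect_calDalev_rho`.
[cite: Balaban1984PropagatorsI, (1.18) p.20, (1.71) p.30 (objects); King1986, Lemma 4.5 (4.38) p.674 (shape)] -/
theorem decayStations_unitCovB (hL : 2 ≤ L) {a' κ : ℝ} (ha' : 0 < a') (hκ : 0 ≤ κ) (hγ' : Jfree d a' κ 1 < gammaPs d a')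
    (hδ' : deltaK d a' κ 1 < sigma0 d a' ^ 2) (hJA : JA d a a' κ 1 < gamD d a) :
    ∃ clim : Matrix (idx L M 0) (idx L M 0) ℂ,
      Tendsto (unitCovB L M a ha) atTop (𝓝 clim) ∧
      EntryDecay (distK L M) clim ((gamD d a - max (JA d a a' κ 1) 0)⁻¹ * Real.exp (κ * 4)) κ ∧
      DecayRate (distK L M) (unitCovB L M a ha) clim
        (Real.sqrt (2 * ((gamD d a - max (JA d a a' κ 1) 0)⁻¹ * Real.exp (κ * 4)) * (CQB d a / (1 - (L : ℝ)⁻¹)))) (κ / 2) (Real.sqrt ((L : ℝ)⁻¹)) ∧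
      TwoLevelDecayRate (distK L M) (unitCovB L M a ha)
        (Real.sqrt (2 * ((gamD d a - max (JA d a a' κ 1) 0)⁻¹ * Real.exp (κ * 4)) * (2 * CQB d a / (1 - (L : ℝ)⁻¹)))) (κ / 2) (Real.sqrt ((L : ℝ)⁻¹)) := by
  have hL1 : (1 : ℝ) < L := by exact_mod_cast (lt_of_lt_of_le one_lt_two hL : 1 < L)
  have hρ0 : (0 : ℝ) ≤ (L : ℝ)⁻¹ := inv_nonneg.mpr (Nat.cast_nonneg _)
  have hρ1 : ((L : ℝ)⁻¹) < 1 := inv_lt_one_of_one_lt₀ hL1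
  have hJγ : max (JA d a a' κ 1) 0 < gamD d a := max_JA_lt_gamD a hJA
  have hW : ∀ (k : ℕ) (y : idx L M 0), WCoercive (calDalev L M a ha k) κ (rho L M k y) (gamD d a - max (JA d a a' κ 1) 0) :=
    fun k y => wCoercive_calDa_of_conjDefect (lev L k) (one_le_lev' L k) M a ha (conjDefect_calDalev_rho L M a ha ha' hγ' hδ' k y)
  exact decayRate_of_towerLimitRate hρ0 hρ1 (CQB_nonneg d a) (towerLimitRate_QB L M a ha hL)
    (hdec_unitCovB_of_wCoercive L M a ha hκ (sub_pos.mpr hJγ) hW)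

/-- **`exists_rate_unitCovB` — (CONV-C)'s QUANTIFIER ORDER FOR `Q_k𝒢Q_kᴴ` WITH BAŁABAN's AVERAGING** [our proof] (`L ≥ 2`): ONE rate `κ ∈ (0, 1]` depending on `(d, a)` only such that for
EVERY torus `M` the two-level shape holds: `‖(unitCovB (k+1) − unitCovB k)(x,y)‖ ≤ B(d, L, a, κ)·(√(L⁻¹))^k·e^{−(κ∕2)·distK(x,y)}` for all `k, x, y`. -/
theorem exists_rate_unitCovB {d : ℕ} (L : ℕ) [NeZero L] (hL : 2 ≤ L) (a : ℝ) (ha : 0 < a) :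
    ∃ κ : ℝ, 0 < κ ∧ κ ≤ 1 ∧ ∀ (M : Fin d → ℕ) [∀ μ, NeZero (M μ)],
      TwoLevelDecayRate (distK L M) (unitCovB L M a ha)
        (Real.sqrt (2 * ((gamD d a - max (JA d a 1 κ 1) 0)⁻¹ * Real.exp (κ * 4)) * (2 * CQB d a / (1 - (L : ℝ)⁻¹)))) (κ / 2) (Real.sqrt ((L : ℝ)⁻¹)) := by
  obtain ⟨κ, hκ0, hκ1, hγ', hδ', hJA⟩ := exists_admissible_rate d a
  refine ⟨κ, hκ0, hκ1, fun M _ => ?_⟩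
  obtain ⟨_, _, _, _, h2⟩ := decayStations_unitCovB L M a ha hL one_pos hκ0.le hγ' hδ' hJA
  exact h2

/-! ## §4 The insertion chains on Bałaban's tower: rate half, decay half, join; the first-order model unconditionally -/

/-- **`towerLimitRate_insertion_QB` — THE RATE HALF ON BAŁABAN's TOWER** [our proof] (`L ≥ 2`): `PerturbationLaws (Δ_a^{(·)}) P J κ₀ (C₂L^{−k})` ⟹ for every order `n`
`TowerLimitRate QBlev L^d (k ↦ (𝒢^{(k)}P_k)^n𝒢^{(k)}) C^B_n L⁻¹`, `C^B_n = (n+1)κ₀^nCJ + nκ₀^{n−1}C₂ + κ₀^n(2dCst + 2·dLCst)` — PART 115 over NE2's `freeTowerLaws_balaban`. -/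
theorem towerLimitRate_insertion_QB (hL : 2 ≤ L) {P : (k : ℕ) → Matrix (idx L M k) (idx L M k) ℂ} {κ₀ C₂ : ℝ}
    (hpert : PerturbationLaws (calDalev L M a ha) P (JpcT L M) κ₀ (fun k => C₂ * ((L : ℝ)⁻¹) ^ k)) (n : ℕ) :
    TowerLimitRate (QBlev L M) ((L : ℝ) ^ d) (fun k => ((calDalev L M a ha k)⁻¹ * P k) ^ n * (calDalev L M a ha k)⁻¹)
      (((n + 1) * κ₀ ^ n * CJ d a + n * κ₀ ^ (n - 1) * C₂) + κ₀ ^ n * (2 * d * Cst d a + 2 * (d * L * Cst d a))) ((L : ℝ)⁻¹) := by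
  have hL1 : (1 : ℝ) < L := by exact_mod_cast (lt_of_lt_of_le one_lt_two hL : 1 < L)
  have hr : (0 : ℝ) < (L : ℝ) ^ d := pow_pos (lt_trans zero_lt_one hL1) d
  exact towerLimitRate_insertion hr (freeTowerLaws_balaban L M a ha) hpert (inv_lt_one_of_one_lt₀ hL1)
    (fun k => le_rfl) (fun k => le_rfl) (fun k => le_rfl) (fun k => le_rfl) n

/-- **`hdecB_insertion_of_wCoercive` — THE DECAY HALF ON BAŁABAN's TOWER** [our proof]: `hW` + `hPc` ⟹ `EntryDecay distK (c^{(n)}_k) (γw⁻¹κ′^n·e^{4κ}) κ`, every `n, k`. -/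
theorem hdecB_insertion_of_wCoercive {P : (k : ℕ) → Matrix (idx L M k) (idx L M k) ℂ} {κ γw κ' : ℝ} (hκ : 0 ≤ κ) (hγ : 0 < γw)
    (hW : ∀ (k : ℕ) (y : idx L M 0), WCoercive (calDalev L M a ha k) κ (rho L M k y) γw)
    (hPc : ∀ (k : ℕ) (y : idx L M 0),
      ‖conjMat κ (rho L M k y) (rho L M k y) (P k) * conjMat κ (rho L M k y) (rho L M k y) (calDalev L M a ha k)⁻¹‖ ≤ κ')
    (n k : ℕ) :
    EntryDecay (distK L M)
      (avgTow (QBlev L M) ((L : ℝ) ^ d) (fun k => ((calDalev L M a ha k)⁻¹ * P k) ^ n * (calDalev L M a ha k)⁻¹) k)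
      (γw⁻¹ * κ' ^ n * Real.exp (κ * 4)) κ :=
  hdecB_of_conjBound L M hκ (fun k y => opNorm_conjMat_insertion_le_of_wCoercive (hW k y) hγ (hPc k y) n) k

/-- **`decayStations_insertion_QB` — THE JOIN ON BAŁABAN's TOWER** [our proof] (`L ≥ 2`): `PerturbationLaws (Δ_a^{(·)}) P J κ₀ (C₂L^{−k})` + `hW` + `hPc` ⟹ for every order `n` the
(1.18)-averaged unit-lattice images of `(𝒢^{(k)}P_k)^n𝒢^{(k)}` converge to a limit with entry decay `(γw⁻¹κ′^n e^{4κ}, κ)` and obey King's two shapes at `(κ∕2, √(L⁻¹))` with the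
displayed constants. [cite: King1986, Lemma 4.5 (4.38) p.674 (shape)] -/
theorem decayStations_insertion_QB (hL : 2 ≤ L) {P : (k : ℕ) → Matrix (idx L M k) (idx L M k) ℂ} {κ₀ C₂ : ℝ}
    (hpert : PerturbationLaws (calDalev L M a ha) P (JpcT L M) κ₀ (fun k => C₂ * ((L : ℝ)⁻¹) ^ k))
    {κ γw κ' : ℝ} (hκ : 0 ≤ κ) (hγ : 0 < γw) (hW : ∀ (k : ℕ) (y : idx L M 0), WCoercive (calDalev L M a ha k) κ (rho L M k y) γw)
    (hPc : ∀ (k : ℕ) (y : idx L M 0),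
      ‖conjMat κ (rho L M k y) (rho L M k y) (P k) * conjMat κ (rho L M k y) (rho L M k y) (calDalev L M a ha k)⁻¹‖ ≤ κ')
    (n : ℕ) :
    ∃ clim : Matrix (idx L M 0) (idx L M 0) ℂ,
      Tendsto (avgTow (QBlev L M) ((L : ℝ) ^ d) (fun k => ((calDalev L M a ha k)⁻¹ * P k) ^ n * (calDalev L M a ha k)⁻¹)) atTop (𝓝 clim) ∧
      EntryDecay (distK L M) clim (γw⁻¹ * κ' ^ n * Real.exp (κ * 4)) κ ∧
      DecayRate (distK L M) (avgTow (QBlev L M) ((L : ℝ) ^ d) (fun k => ((calDalev L M a ha k)⁻¹ * P k) ^ n * (calDalev L M a ha k)⁻¹)) clim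
        (Real.sqrt (2 * (γw⁻¹ * κ' ^ n * Real.exp (κ * 4))
          * ((((n + 1) * κ₀ ^ n * CJ d a + n * κ₀ ^ (n - 1) * C₂) + κ₀ ^ n * (2 * d * Cst d a + 2 * (d * L * Cst d a))) / (1 - (L : ℝ)⁻¹))))
        (κ / 2) (Real.sqrt ((L : ℝ)⁻¹)) ∧
      TwoLevelDecayRate (distK L M) (avgTow (QBlev L M) ((L : ℝ) ^ d) (fun k => ((calDalev L M a ha k)⁻¹ * P k) ^ n * (calDalev L M a ha k)⁻¹))
        (Real.sqrt (2 * (γw⁻¹ * κ' ^ n * Real.exp (κ * 4))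
          * (2 * (((n + 1) * κ₀ ^ n * CJ d a + n * κ₀ ^ (n - 1) * C₂) + κ₀ ^ n * (2 * d * Cst d a + 2 * (d * L * Cst d a))) / (1 - (L : ℝ)⁻¹))))
        (κ / 2) (Real.sqrt ((L : ℝ)⁻¹)) := by
  have hL1 : (1 : ℝ) < L := by exact_mod_cast (lt_of_lt_of_le one_lt_two hL : 1 < L)
  have hρ0 : (0 : ℝ) ≤ (L : ℝ)⁻¹ := inv_nonneg.mpr (Nat.cast_nonneg _)
  have hρ1 : ((L : ℝ)⁻¹) < 1 := inv_lt_one_of_one_lt₀ hL1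
  obtain ⟨hκ₀, hC₂⟩ := nonneg_of_perturbationLaws L M a ha hpert
  have hC : 0 ≤ ((n + 1) * κ₀ ^ n * CJ d a + n * κ₀ ^ (n - 1) * C₂) + κ₀ ^ n * (2 * d * Cst d a + 2 * (d * L * Cst d a)) := by
    have h1 := CJ_nonneg d a
    have h2 := Cst_nonneg d a
    positivity
  exact decayRate_of_towerLimitRate hρ0 hρ1 hC (towerLimitRate_insertion_QB L M a ha hL hpert n) (hdecB_insertion_of_wCoercive L M a ha hκ hγ hW hPc n)

/-- **`decayStations_firstOrderInsertion_QB` — THE FIRST-ORDER MODEL ON BAŁABAN's TOWER, UNCONDITIONALLY** [our proof] (`L ≥ 2`, `d ≥ 1`; `a′ > 0`, `κ ≥ 0` below the three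
closed-form thresholds): for `LipschitzBackground V α β` and every order `n`, the (1.18)-averaged unit-lattice images of `(𝒢^{(k)}P_k)^n𝒢^{(k)}` converge to a limit with entry
decay at rate `κ` and obey King's two shapes at `(κ∕2, √(L⁻¹))`, NO displayed binder. [cite: King1986, Lemma 4.5 (4.38) p.674 (shape)] -/
theorem decayStations_firstOrderInsertion_QB (hL : 2 ≤ L) (hd : 1 ≤ d) {V : (k : ℕ) → Fin d → (idx L M k → ℂ)} {α β : ℝ}
    (hV : LipschitzBackground L M V α β) {a' κ : ℝ} (ha' : 0 < a') (hκ : 0 ≤ κ) (hγ' : Jfree d a' κ 1 < gammaPs d a')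
    (hδ' : deltaK d a' κ 1 < sigma0 d a' ^ 2) (hJA : JA d a a' κ 1 < gamD d a) (n : ℕ) :
    ∃ clim : Matrix (idx L M 0) (idx L M 0) ℂ,
      Tendsto (avgTow (QBlev L M) ((L : ℝ) ^ d) (fun k => ((calDalev L M a ha k)⁻¹ * Pmodel L M V k) ^ n * (calDalev L M a ha k)⁻¹)) atTop
        (𝓝 clim) ∧
      EntryDecay (distK L M) clim
        ((gamD d a - max (JA d a a' κ 1) 0)⁻¹ * (d * (α * G2 d a (max (JA d a a' κ 1) 0) (gamD d a - max (JA d a a' κ 1) 0) κ)) ^ n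
          * Real.exp (κ * 4)) κ ∧
      DecayRate (distK L M) (avgTow (QBlev L M) ((L : ℝ) ^ d) (fun k => ((calDalev L M a ha k)⁻¹ * Pmodel L M V k) ^ n * (calDalev L M a ha k)⁻¹))
        clim
        (Real.sqrt (2 * ((gamD d a - max (JA d a a' κ 1) 0)⁻¹
            * (d * (α * G2 d a (max (JA d a a' κ 1) 0) (gamD d a - max (JA d a a' κ 1) 0) κ)) ^ n * Real.exp (κ * 4))
          * ((((n + 1) * (d * (α + β) * Cst d a) ^ n * CJ d a + n * (d * (α + β) * Cst d a) ^ (n - 1) * C2model d L a α β)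
              + (d * (α + β) * Cst d a) ^ n * (2 * d * Cst d a + 2 * (d * L * Cst d a))) / (1 - (L : ℝ)⁻¹))))
        (κ / 2) (Real.sqrt ((L : ℝ)⁻¹)) ∧
      TwoLevelDecayRate (distK L M)
        (avgTow (QBlev L M) ((L : ℝ) ^ d) (fun k => ((calDalev L M a ha k)⁻¹ * Pmodel L M V k) ^ n * (calDalev L M a ha k)⁻¹))
        (Real.sqrt (2 * ((gamD d a - max (JA d a a' κ 1) 0)⁻¹
            * (d * (α * G2 d a (max (JA d a a' κ 1) 0) (gamD d a - max (JA d a a' κ 1) 0) κ)) ^ n * Real.exp (κ * 4))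
          * (2 * (((n + 1) * (d * (α + β) * Cst d a) ^ n * CJ d a + n * (d * (α + β) * Cst d a) ^ (n - 1) * C2model d L a α β)
              + (d * (α + β) * Cst d a) ^ n * (2 * d * Cst d a + 2 * (d * L * Cst d a))) / (1 - (L : ℝ)⁻¹))))
        (κ / 2) (Real.sqrt ((L : ℝ)⁻¹)) := by
  have hJ0 : 0 ≤ max (JA d a a' κ 1) 0 := le_max_right _ _
  have hJγ : max (JA d a a' κ 1) 0 < gamD d a := max_JA_lt_gamD a hJA
  have hW : ∀ (k : ℕ) (y : idx L M 0), WCoercive (calDalev L M a ha k) κ (rho L M k y) (gamD d a - max (JA d a a' κ 1) 0) :=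
    fun k y => wCoercive_calDa_of_conjDefect (lev L k) (one_le_lev' L k) M a ha (conjDefect_calDalev_rho L M a ha ha' hγ' hδ' k y)
  have hPc : ∀ (k : ℕ) (y : idx L M 0),
      ‖conjMat κ (rho L M k y) (rho L M k y) (Pmodel L M V k) * conjMat κ (rho L M k y) (rho L M k y) (calDalev L M a ha k)⁻¹‖
        ≤ d * (α * G2 d a (max (JA d a a' κ 1) 0) (gamD d a - max (JA d a a' κ 1) 0) κ) :=
    fun k y => hPc_firstOrder L M a ha hV hJ0 hJγ k y (conjDefect_calDalev_rho L M a ha ha' hγ' hδ' k y)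
  exact decayStations_insertion_QB L M a ha hL (perturbationLaws_firstOrder L M a ha hd hV) hκ (sub_pos.mpr hJγ) hW hPc n

/-- **`exists_rate_firstOrderInsertion_QB` — (CONV-C)'s QUANTIFIER ORDER ON BAŁABAN's TOWER** [our proof] (`L ≥ 2`, `d ≥ 1`): ONE rate `κ ∈ (0, 1]` depending on `(d, a)` only such
that for EVERY torus, EVERY Lipschitz background and EVERY order `n`: `‖(c^{(n)}_{k+1} − c^{(n)}_k)(x,y)‖ ≤ B·(√(L⁻¹))^k·e^{−(κ∕2)·distK(x,y)}` for all `k, x, y`, NO displayed binder.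
[cite: King1986, Lemma 4.5 (4.38) p.674 (shape)] -/
theorem exists_rate_firstOrderInsertion_QB {d : ℕ} (L : ℕ) [NeZero L] (hL : 2 ≤ L) (hd : 1 ≤ d) (a : ℝ) (ha : 0 < a) :
    ∃ κ : ℝ, 0 < κ ∧ κ ≤ 1 ∧
      ∀ (M : Fin d → ℕ) [∀ μ, NeZero (M μ)] (V : (k : ℕ) → Fin d → (idx L M k → ℂ)) (α β : ℝ) (_hV : LipschitzBackground L M V α β) (n : ℕ),
        TwoLevelDecayRate (distK L M)
          (avgTow (QBlev L M) ((L : ℝ) ^ d) (fun k => ((calDalev L M a ha k)⁻¹ * Pmodel L M V k) ^ n * (calDalev L M a ha k)⁻¹))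
          (Real.sqrt (2 * ((gamD d a - max (JA d a 1 κ 1) 0)⁻¹
              * (d * (α * G2 d a (max (JA d a 1 κ 1) 0) (gamD d a - max (JA d a 1 κ 1) 0) κ)) ^ n * Real.exp (κ * 4))
            * (2 * (((n + 1) * (d * (α + β) * Cst d a) ^ n * CJ d a + n * (d * (α + β) * Cst d a) ^ (n - 1) * C2model d L a α β)
                + (d * (α + β) * Cst d a) ^ n * (2 * d * Cst d a + 2 * (d * L * Cst d a))) / (1 - (L : ℝ)⁻¹))))
          (κ / 2) (Real.sqrt ((L : ℝ)⁻¹)) := by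
  obtain ⟨κ, hκ0, hκ1, hγ', hδ', hJA⟩ := exists_admissible_rate d a
  refine ⟨κ, hκ0, hκ1, fun M _ V α β hV n => ?_⟩
  obtain ⟨_, _, _, _, h2⟩ := decayStations_firstOrderInsertion_QB L M a ha hL hd hV one_pos hκ0.le hγ' hδ' hJA n
  exact h2

end Tower

end Summit.QuantumFields.BalabanUV.Beta.GAN24.InsertionChainDecayBalaban

end
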